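import Mathlib
import HarnessLib
import Literature.NumberTheory.Transcendental.BakerQuantSetup

/-!
# Polynomial Derivative Connection

This file establishes the connection between complex analysis `deriv`/`iteratedDeriv` and
algebraic `Polynomial.derivative` for polynomial functions. These helpers are used for
polynomial exclusion in the TiltedLandingLaw421 proof.

## Main results

* `hasDerivAt_polynomial_eval` — HasDerivAt for polynomial evaluation
* `deriv_polynomial_eval` — deriv equals polynomial derivative evaluation
* `iteratedDeriv_polynomial_eval` — iteratedDeriv equals iterated polynomial derivative
* `polynomial_iteratedDeriv_eq_zero` — iteratedDeriv is zero beyond polynomial degree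
* `not_polynomial_of_all_iteratedDeriv_ne_zero` — contrapositive for polynomial exclusion
-/

open Complex Polynomial

/-- The derivative of polynomial evaluation at a point equals the polynomial derivative evaluated
at that point. This is the HasDerivAt version. -/
theorem hasDerivAt_polynomial_eval (p : ℂ[X]) (z : ℂ) :
    HasDerivAt (fun w => p.eval w) ((derivative p).eval z) z := by
  -- Induction on polynomial structure
  induction p using Polynomial.induction_on' with
  | add p q hp hq =>
    simp only [eval_add, derivative_add]
    exact hp.add hq
  | monomial n a =>
    simp only [eval_monomial, derivative_monomial]
    -- d/dz (a * z^n) = a * n * z^{n-1}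
    -- Need: HasDerivAt (fun w => a * w^n) (a * n * z^{n-1}) z
    by_cases hn : n = 0
    · -- n = 0: HasDerivAt (fun w => a * w^0) (a * 0 * z ^ (0 - 1)) z
      -- = HasDerivAt (fun w => a) 0 z (since w^0 = 1 and a * 0 * ... = 0)
      subst hn
      simp only [pow_zero, mul_one, Nat.cast_zero, mul_zero, zero_mul]
      exact hasDerivAt_const z a
    · -- n ≥ 1
      have hn' : n ≠ 0 := hn
      have h1 : HasDerivAt (fun w => w^n) (n * z^(n-1)) z := hasDerivAt_pow n z
      have h2 : HasDerivAt (fun w => a * w^n) (a * (n * z^(n-1))) z := h1.const_mul a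
      convert h2 using 1
      -- Goal: a * ↑n * z ^ (n - 1) = a * (↑n * z ^ (n - 1))
      ring

/-- The derivative of polynomial evaluation equals polynomial derivative evaluation. -/
theorem deriv_polynomial_eval (p : ℂ[X]) :
    deriv (fun z => p.eval z) = fun z => (derivative p).eval z := by
  funext z
  exact (hasDerivAt_polynomial_eval p z).deriv

-- Use the tree version of iteratedDeriv_polynomial_eval
open Literature.NumberTheory.Transcendental.Baker1975.Ch3 (iteratedDeriv_polynomial_eval)

/-- For a polynomial, iteratedDeriv beyond the degree is zero. This follows from
`Polynomial.iterate_derivative_eq_zero` and the connection `iteratedDeriv_polynomial_eval`. -/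
theorem polynomial_iteratedDeriv_eq_zero {p : ℂ[X]} (j : ℕ) (hj : p.natDegree < j) :
    iteratedDeriv j (fun z => p.eval z) = 0 := by
  rw [iteratedDeriv_polynomial_eval]
  -- derivative^[j] p = 0 when j > natDegree p
  -- This is Polynomial.iterate_derivative_eq_zero from Mathlib
  have h : derivative^[j] p = 0 := Polynomial.iterate_derivative_eq_zero hj
  simp only [h, eval_zero]
  rfl

/-- If all iteratedDeriv are nonzero, then f is not a polynomial. This is the contrapositive
of the fact that polynomials have vanishing high derivatives. -/
theorem not_polynomial_of_all_iteratedDeriv_ne_zero {f : ℂ → ℂ}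
    (hf : ∀ j : ℕ, iteratedDeriv j f ≠ 0) : ¬∃ p : Polynomial ℂ, f = fun z => p.eval z := by
  intro ⟨p, hp⟩
  have h := hf (p.natDegree + 1)
  rw [hp] at h
  exact h (polynomial_iteratedDeriv_eq_zero (p.natDegree + 1) (Nat.lt_succ_self _))
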